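import Literature.Computability.Cryptography.ChenQuantumLWENonDisturbing

/-!
# Every non-demolition operation on the Step-9 line kets is class-blind; the Step-8 datum is the eigenvalue of a public stabiliser (T4, operator form)

REPRODUCTION / ANALYSIS OF A CLAIMED RESULT UNDER ADJUDICATION (withdrawn): Yilei Chen, *Quantum
Algorithms for Lattice Problems*, IACR ePrint 2024/555, version of 2024-04-18 [ChenQuantumLattice2024]
(the version carrying the author's note that Step 9 contains a bug), Step 9 (§3.5.9, pp. 34–38) acting
on the line ket `|φ8.b⟩ = Σ_{j ∈ ℤ_P} e(-j²/P) |2D²j·b + v′ mod N⟩` (p. 35), Claim 3.14 (pp. 33–34) and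
eq. (12) (p. 17).  Bundle `papers/QuantumAdvantage/lwe-quantum-autopsy/`, Part 2 (`REPAIR-CENSUS.md`
§1 **T4**, §12), sequel of `ChenQuantumLWENonDisturbing.lean` and `ChenQuantumLWELineInvariants.lean`.
HONEST FRAMING: kernel-checked THEOREMS about states occurring in a WITHDRAWN algorithm — the operator
form of a NO-GO for in-run repairs of Step 9, NOT summit progress, no cryptanalytic claim in either
direction, no new algorithm; quantum lower bounds are out of scope.

## What is proved

`ChenQuantumLWENonDisturbing` settled the modelling sentence of census item T4 for computational-basis
measurements.  Here it is settled for ARBITRARY LINEAR OPERATIONS (Kraus operators of any instrument):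
call `E` NON-DEMOLITION on `ψ` if `Eψ ∈ ℂψ` (`IsNonDemolition`), and CLASS-NON-DEMOLITION
(`IsClassND`) if it is non-demolition on the line ket `|φ_{b,v′}⟩` of EVERY class secret `b` (`b = bk` off
the unknown coordinates `U`, `2p₁ ∣ b` on `U`, eq. (12)) and EVERY offset `v′` — the operations a
secret-ignorant algorithm may apply to `|φ8.b⟩` with the guarantee that the state survives.  Its
eigenvalue `ndValue E b v′ = (E|φ_{b,v′}⟩)(v′ mod N)` is everything such an operation reveals.  Then, for
odd `P = p₁Q`, odd `Q`, `gcd(p₁,Q) = 1`, `0 ∉ U ≠ ∅`, `bk₀ = −1`: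

* `sum_conj_chirp_smul_phi8bKet` — the chirp family through an offset resolves the basis ket there:
  `Σ_{t ∈ ℤ_P} conj ψ_P(−t²) · |φ_{b, v′−2D²t·b}⟩ = P·|v′⟩` (chirp autocorrelation `chirp_autocorrelation`);
  hence `nd_expansion`: `P·E|v′⟩ = Σ_j ψ_P(−j²)·λ̂(−2j) |2D²j·b + v′⟩`, `λ̂` the Fourier transform of the
  eigenvalues `λ(t)` of `E` along the line (`evProfile`).
* **`IsClassND.ndValue_secret_indep`** — two class secrets expand the same vector `E|v′⟩` along lines
  meeting (generically) only at `v′`; comparing the two expansions and inverting the Fourier transform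
  (`profileDFT_inversion`) gives `ndValue E b v′ = ndValue E b′ v′` for all class secrets `b, b′`.
* **`IsClassND.ndValue_lineShift_p₁_mul`** — comparing `b` with `b + 2p₁𝟙_{i₀}` (`i₀ ∈ U`) kills
  `λ̂` off the multiples of `Q`, so `λ` has period `p₁` along the line: the offset may move `p₁m` steps.
* **`IsClassND.ndValue_classShift`**, **`IsClassND.ndValue_class_blind`** — consequently the eigenvalue
  is the same at `v′` and at every class-shifted offset `v′ + D²p₁(a·bk + c·𝟙_U)` and for every class
  secret: a class-non-demolition operation cannot contribute to the centre correction that Step 9 needs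
  (`ChenQuantumLWEClassTwirl`: `centreError` sweeps all of `ℤ_Q` under the class shifts).
* SHARPNESS — **`step8Op_phi8bKet`**: the public operator `(E₈ψ)(x) = ψ_{p₁}(x₀ mod p₁)·ψ(x − 2D⁴Q·bk⁰)`
  (`bk⁰ = bk` off `U`, `0` on `U`; a diagonal phase times a translation, both secret-free) stabilises
  every class line ket with eigenvalue `ψ_{p₁}(v′₀)·ψ_P(−D⁴Q²)`: Chen's Step-8 datum `v′₀ mod D²p₁`
  (Claim 3.14) IS the eigenvalue of a class-non-demolition operation, given the line invariant
  `v′₀ mod D²` (`isLineInvariant_toDsq`) and `gcd(D,p₁) = 1`.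
* **`nd_indistinguishable_iff`** (T4, operator form) — two offsets receive the same eigenvalue from EVERY
  class-non-demolition operation iff they differ by a class shift mod `N`: what can be learnt about the
  offset of `|φ8.b⟩` without risking the state is EXACTLY its class, and the class does not know the centre.
* `Shape.ndValue_class_blind`, `Shape.nd_indistinguishable_iff` — the same for Chen's admissible shapes
  (Cond. C.3), the class secrets being the other LWE instances with the same planted part.

## What is NOT here

Operations that do disturb the state (covered run-by-run by the class-twirl theorem
`twirl_statistic_indep` of `ChenQuantumLWEClassTwirl` for processing in the commuting class `K`, and by
the window theorems for destructive `j`-windowing); adaptive multi-copy strategies beyond the product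
structure recorded in `twirl_multiRun_indep`; the bookkeeping that Claim 3.14 is the only other offset
source in Steps 1–8 (census T6); quantum query lower bounds.
-/

namespace Literature.Computability.Cryptography.Chen2024

open scoped BigOperators

/-! ### Non-demolition linear operations -/

section General

variable {k m : ℕ}

/-- The computational-basis ket `|y⟩`. [folklore] -/
noncomputable def basisKet (y : Fin k → ZMod m) : Ket k m := fun z => if z = y then 1 else 0

/-- `E` is a NON-DEMOLITION operation on `ψ`: `Eψ ∈ ℂψ`.  For a Kraus operator `E` of an instrument
this says: the branch `E` leaves the ray of `ψ` intact (or has probability `0`). [folklore] -/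
def IsNonDemolition (E : Ket k m →ₗ[ℂ] Ket k m) (ψ : Ket k m) : Prop := ∃ l : ℂ, E ψ = l • ψ

/-- The `M`-branch `ψ ↦ 𝟙_M·ψ` of the computational-basis measurement `{M, Mᶜ}` as a linear
operation. [folklore] -/
noncomputable def branchOp (M : Set (Fin k → ZMod m)) : Ket k m →ₗ[ℂ] Ket k m where
  toFun ψ := M.indicator ψ
  map_add' ψ φ := by
    classical
    funext x
    simp only [Set.indicator_apply, Pi.add_apply]
    split_ifs <;> simp
  map_smul' a ψ := by
    classical
    funext x
    simp only [Set.indicator_apply, Pi.smul_apply, smul_eq_mul, RingHom.id_apply]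
    split_ifs <;> simp

/-- `branchOp M ψ = 𝟙_M·ψ`. [folklore] -/
@[simp] theorem branchOp_apply (M : Set (Fin k → ZMod m)) (ψ : Ket k m) : branchOp M ψ = M.indicator ψ :=
  rfl

/-- The basis measurement `{M, Mᶜ}` is non-disturbing (`ChenQuantumLWENonDisturbing`) iff its `M`-branch
is a non-demolition operation. [folklore] -/
theorem isNonDemolition_branchOp_iff (M : Set (Fin k → ZMod m)) (ψ : Ket k m) :
    IsNonDemolition (branchOp M) ψ ↔ IsNonDisturbing M ψ :=
  Iff.rfl

/-- If `ψ x = 1`, the eigenvalue of a non-demolition operation on `ψ` is the amplitude `(Eψ)(x)`.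
[folklore] -/
theorem eigenvalue_eq_apply {E : Ket k m →ₗ[ℂ] Ket k m} {ψ : Ket k m} {l : ℂ} (h : E ψ = l • ψ)
    {x : Fin k → ZMod m} (hx : ψ x = 1) : l = E ψ x := by
  rw [h, Pi.smul_apply, smul_eq_mul, hx, mul_one]

/-- Superposing line kets on the same points superposes their profiles. [folklore] -/
theorem sum_smul_lineKet {ι κ : Type*} [Fintype ι] [Fintype κ] (pt : ι → (Fin k → ZMod m))
    (a : κ → ℂ) (c : κ → ι → ℂ) :
    ∑ t, a t • lineKet pt (c t) = lineKet pt (fun j => ∑ t, a t * c t j) := by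
  funext z
  rw [Finset.sum_apply]
  unfold lineKet
  simp only [Pi.smul_apply, smul_eq_mul, Finset.mul_sum, mul_ite, mul_zero]
  rw [Finset.sum_comm]
  refine Finset.sum_congr rfl fun j _ => ?_
  split_ifs with h
  · rfl
  · simp

/-- A profile concentrated at one parameter gives a multiple of the basis ket there. [folklore] -/
theorem lineKet_single {ι : Type*} [Fintype ι] [DecidableEq ι] (pt : ι → (Fin k → ZMod m)) (j₀ : ι)
    (a : ℂ) : lineKet pt (fun j => if j = j₀ then a else 0) = a • basisKet (pt j₀) := by
  funext z
  simp only [lineKet, basisKet, Pi.smul_apply, smul_eq_mul, mul_ite, mul_one, mul_zero]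
  rw [Finset.sum_eq_single j₀ (fun j _ hj => by rw [if_neg hj, ite_self])
    (fun h => absurd (Finset.mem_univ _) h)]
  rw [if_pos rfl]

/-- The standard additive character of `ℤ_m` is injective. [folklore] -/
theorem stdAddChar_injective {m : ℕ} [NeZero m] {x y : ZMod m}
    (h : (ZMod.stdAddChar x : ℂ) = ZMod.stdAddChar y) : x = y := by
  have e : (ZMod.stdAddChar (x - y) : ℂ) * ZMod.stdAddChar y = ZMod.stdAddChar y := by
    rw [← AddChar.map_add_eq_mul, sub_add_cancel]; exact h
  have h1 : (ZMod.stdAddChar (x - y) : ℂ) = 1 := (mul_eq_right₀ (stdAddChar_ne_zero y)).1 e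
  exact sub_eq_zero.1 (((ZMod.isPrimitive_stdAddChar m).zmod_char_eq_one_iff m (x - y)).1 h1)

end General

/-! ### The chirp family along a line: moving the offset, autocorrelation, expansion of `E|v′⟩` -/

section Line

variable (n : ℕ) (D p₁ Q : ℕ+)

/-- The offset moved `t` steps along the line of `b`: `v′ + 2D²t·b`.
[cite: ChenQuantumLattice2024, §3.5.9 p. 35] -/
def lineShift (b v' : Fin (n + 1) → ℤ) (t : ℤ) : Fin (n + 1) → ℤ :=
  fun i => v' i + 2 * ((D : ℕ) : ℤ) ^ 2 * t * b i

/-- Moving `0` steps. [folklore] -/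
theorem lineShift_zero (b v' : Fin (n + 1) → ℤ) : lineShift n D b v' 0 = v' := by
  funext i; simp [lineShift]

/-- Moving `t` then `t′` steps is moving `t + t′` steps. [folklore] -/
theorem lineShift_lineShift (b v' : Fin (n + 1) → ℤ) (t t' : ℤ) :
    lineShift n D b (lineShift n D b v' t) t' = lineShift n D b v' (t + t') := by
  funext i; simp only [lineShift]; ring

/-- Moving the offset `t` steps re-parametrises the line by `j ↦ j + t`.
[cite: ChenQuantumLattice2024, §3.5.9 p. 35] -/
theorem ptB_lineShift (b v' : Fin (n + 1) → ℤ) (t : ℤ) (j : ZP p₁ Q) :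
    ptB n D p₁ Q b (lineShift n D b v' t) j = ptB n D p₁ Q b v' (j + ((t : ℤ) : ZP p₁ Q)) := by
  have hj : (((j.val : ℕ) : ℤ) : ZP p₁ Q) = j := by rw [Int.cast_natCast, ZMod.natCast_zmod_val]
  have e1 : ptB n D p₁ Q b (lineShift n D b v' t) j
      = ptB n D p₁ Q b (lineShift n D b v' t) (((j.val : ℕ) : ℤ) : ZP p₁ Q) := by rw [hj]
  have e2 : j + ((t : ℤ) : ZP p₁ Q) = ((((j.val : ℕ) : ℤ) + t : ℤ) : ZP p₁ Q) := by rw [Int.cast_add, hj]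
  rw [e1, e2, ptB_intCast, ptB_intCast]
  funext i
  simp only [Pi.add_apply, lineShift, dirStep]
  push_cast
  ring

/-- The cast of a moved offset depends on `t mod P` only. [folklore] -/
theorem lineShift_cast_eq_of_modEq (b v' : Fin (n + 1) → ℤ) {t t' : ℤ}
    (h : t ≡ t' [ZMOD (((p₁ * Q : ℕ+) : ℕ) : ℤ)]) (i : Fin (n + 1)) :
    ((lineShift n D b v' t i : ℤ) : ZN D p₁ Q) = ((lineShift n D b v' t' i : ℤ) : ZN D p₁ Q) := by
  simp only [lineShift, Int.cast_add]
  rw [twoDsq_mul_eq_of_modEq D p₁ Q (b i) h]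

/-- Moving the offset along the line re-indexes the chirp:
`|φ_{b, v′+2D²t·b}⟩ = Σ_j ψ_P(−(j−t)²) |2D²j·b + v′⟩`. [cite: ChenQuantumLattice2024, §3.5.9 p. 35] -/
theorem phi8bKet_lineShift (b v' : Fin (n + 1) → ℤ) (t : ℤ) :
    phi8bKet n D p₁ Q b (lineShift n D b v' t)
      = lineKet (ptB n D p₁ Q b v')
          (fun j => (ZMod.stdAddChar (-((j - ((t : ℤ) : ZP p₁ Q)) ^ 2) : ZP p₁ Q) : ℂ)) := by
  funext z
  unfold phi8bKet lineKet
  simp_rw [ptB_lineShift]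
  exact Fintype.sum_equiv (Equiv.addRight ((t : ℤ) : ZP p₁ Q)) _ _ (fun j => by
    simp only [Equiv.coe_addRight, add_sub_cancel_right])

/-- The member `t ∈ ℤ_P` of the chirp family through `v′`: `|φ_{b, v′−2D²t·b}⟩ = Σ_j ψ_P(−(j+t)²)|2D²j·b + v′⟩`.
[cite: ChenQuantumLattice2024, §3.5.9 p. 35] -/
theorem phi8bKet_lineShift_negVal (b v' : Fin (n + 1) → ℤ) (t : ZP p₁ Q) :
    phi8bKet n D p₁ Q b (lineShift n D b v' (-((t.val : ℕ) : ℤ)))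
      = lineKet (ptB n D p₁ Q b v') (fun j => (ZMod.stdAddChar (-((j + t) ^ 2) : ZP p₁ Q) : ℂ)) := by
  rw [phi8bKet_lineShift]
  congr 1
  funext j
  rw [Int.cast_neg, Int.cast_natCast, ZMod.natCast_zmod_val, sub_neg_eq_add]

/-- `conj ψ_P(−t²)·ψ_P(−(i+t)²) = ψ_P(−i²)·ψ_P(t·(−2i))`. [folklore] -/
theorem conj_chirp_mul_chirp_add (i t : ZP p₁ Q) :
    (starRingEnd ℂ) (ZMod.stdAddChar (-(t ^ 2) : ZP p₁ Q) : ℂ)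
        * (ZMod.stdAddChar (-((i + t) ^ 2) : ZP p₁ Q) : ℂ)
      = (ZMod.stdAddChar (-(i ^ 2) : ZP p₁ Q) : ℂ) * (ZMod.stdAddChar (t * (-(2 * i)) : ZP p₁ Q) : ℂ) := by
  rw [← AddChar.map_neg_eq_conj, ← AddChar.map_add_eq_mul, ← AddChar.map_add_eq_mul]
  congr 1
  ring

/-- **Chirp autocorrelation**: `Σ_t conj ψ_P(−t²)·ψ_P(−(i+t)²) = P·[i = 0]` for odd `P` (a chirp is
orthogonal to all its proper translates). [folklore] -/
theorem chirp_autocorrelation (hP : Odd ((p₁ * Q : ℕ+) : ℕ)) (i : ZP p₁ Q) :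
    ∑ t : ZP p₁ Q, (starRingEnd ℂ) (ZMod.stdAddChar (-(t ^ 2) : ZP p₁ Q) : ℂ)
        * (ZMod.stdAddChar (-((i + t) ^ 2) : ZP p₁ Q) : ℂ)
      = if i = 0 then (((p₁ * Q : ℕ+) : ℕ) : ℂ) else 0 := by
  simp_rw [conj_chirp_mul_chirp_add]
  rw [← Finset.mul_sum, AddChar.sum_mulShift _ (ZMod.isPrimitive_stdAddChar _), ZMod.card]
  by_cases hi : i = 0
  · subst hi
    have h0 : (-((0 : ZP p₁ Q) ^ 2) : ZP p₁ Q) = 0 := by ring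
    have h2 : (-(2 * (0 : ZP p₁ Q)) : ZP p₁ Q) = 0 := by ring
    have h1 : (ZMod.stdAddChar (0 : ZP p₁ Q) : ℂ) = 1 := AddChar.map_zero_eq_one _
    rw [h0, h2, h1, one_mul, if_pos rfl, if_pos rfl]
  · have h2 : -(2 * i) ≠ 0 := by
      rw [Ne, neg_eq_zero, (Literature.NumberTheory.GaussSums.isUnit_two_zmod_of_odd _ hP).mul_right_eq_zero]
      exact hi
    rw [if_neg hi, if_neg h2, Nat.cast_zero, mul_zero]

/-- **The chirp family through an offset resolves the basis ket there**:
`Σ_{t ∈ ℤ_P} conj ψ_P(−t²) · |φ_{b, v′−2D²t·b}⟩ = P·|v′ mod N⟩` (odd `P`; any direction `b`).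
[cite: ChenQuantumLattice2024, §3.5.9 p. 35; folklore] -/
theorem sum_conj_chirp_smul_phi8bKet (hP : Odd ((p₁ * Q : ℕ+) : ℕ)) (b v' : Fin (n + 1) → ℤ) :
    ∑ t : ZP p₁ Q, (starRingEnd ℂ) (ZMod.stdAddChar (-(t ^ 2) : ZP p₁ Q) : ℂ)
        • phi8bKet n D p₁ Q b (lineShift n D b v' (-((t.val : ℕ) : ℤ)))
      = (((p₁ * Q : ℕ+) : ℕ) : ℂ) • basisKet (fun i => ((v' i : ℤ) : ZN D p₁ Q)) := by
  simp_rw [phi8bKet_lineShift_negVal]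
  rw [sum_smul_lineKet]
  simp_rw [chirp_autocorrelation p₁ Q hP]
  rw [lineKet_single, ptB_zero]

/-- **Expansion of `E|v′⟩` in the chirp family.** If `E|φ_{b,v′−2D²t·b}⟩ = λ(t)·|φ_{b,v′−2D²t·b}⟩` for
all `t ∈ ℤ_P`, then `P·E|v′⟩ = Σ_j ψ_P(−j²)·λ̂(−2j) |2D²j·b + v′⟩` with `λ̂ = profileDFT λ`: a vector
supported on the line of `b` through `v′`. [cite: ChenQuantumLattice2024, §3.5.9 p. 35; folklore] -/
theorem nd_expansion (hP : Odd ((p₁ * Q : ℕ+) : ℕ)) (b v' : Fin (n + 1) → ℤ)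
    (E : Ket (n + 1) ((D * D * (p₁ * Q) : ℕ+) : ℕ) →ₗ[ℂ] Ket (n + 1) ((D * D * (p₁ * Q) : ℕ+) : ℕ))
    (l : ZP p₁ Q → ℂ)
    (hE : ∀ t : ZP p₁ Q, E (phi8bKet n D p₁ Q b (lineShift n D b v' (-((t.val : ℕ) : ℤ))))
      = l t • phi8bKet n D p₁ Q b (lineShift n D b v' (-((t.val : ℕ) : ℤ)))) :
    (((p₁ * Q : ℕ+) : ℕ) : ℂ) • E (basisKet fun i => ((v' i : ℤ) : ZN D p₁ Q))
      = lineKet (ptB n D p₁ Q b v')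
          (fun j => (ZMod.stdAddChar (-(j ^ 2) : ZP p₁ Q) : ℂ) * profileDFT p₁ Q l (-(2 * j))) := by
  rw [← map_smul, ← sum_conj_chirp_smul_phi8bKet n D p₁ Q hP b v', map_sum]
  have hE' : ∀ t : ZP p₁ Q,
      E ((starRingEnd ℂ) (ZMod.stdAddChar (-(t ^ 2) : ZP p₁ Q) : ℂ)
          • phi8bKet n D p₁ Q b (lineShift n D b v' (-((t.val : ℕ) : ℤ))))
        = ((starRingEnd ℂ) (ZMod.stdAddChar (-(t ^ 2) : ZP p₁ Q) : ℂ) * l t)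
          • lineKet (ptB n D p₁ Q b v') (fun j => (ZMod.stdAddChar (-((j + t) ^ 2) : ZP p₁ Q) : ℂ)) := by
    intro t
    rw [map_smul, hE t, smul_smul, phi8bKet_lineShift_negVal]
  simp_rw [hE']
  rw [sum_smul_lineKet]
  congr 1
  funext j
  unfold profileDFT
  rw [Finset.mul_sum]
  refine Finset.sum_congr rfl fun t _ => ?_
  calc (starRingEnd ℂ) (ZMod.stdAddChar (-(t ^ 2) : ZP p₁ Q) : ℂ) * l t
          * (ZMod.stdAddChar (-((j + t) ^ 2) : ZP p₁ Q) : ℂ)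
      = l t * ((starRingEnd ℂ) (ZMod.stdAddChar (-(t ^ 2) : ZP p₁ Q) : ℂ)
          * (ZMod.stdAddChar (-((j + t) ^ 2) : ZP p₁ Q) : ℂ)) := by ring
    _ = l t * ((ZMod.stdAddChar (-(j ^ 2) : ZP p₁ Q) : ℂ)
          * (ZMod.stdAddChar (t * (-(2 * j)) : ZP p₁ Q) : ℂ)) := by rw [conj_chirp_mul_chirp_add]
    _ = (ZMod.stdAddChar (-(j ^ 2) : ZP p₁ Q) : ℂ)
          * (l t * (ZMod.stdAddChar (t * (-(2 * j)) : ZP p₁ Q) : ℂ)) := by ring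

/-- **Fourier inversion on `ℤ_P`**: `Σ_s ĉ(s)·ψ_P(−k·s) = P·c(k)`. [folklore] -/
theorem profileDFT_inversion (c : ZP p₁ Q → ℂ) (k : ZP p₁ Q) :
    ∑ s : ZP p₁ Q, profileDFT p₁ Q c s * (ZMod.stdAddChar (-(k * s)) : ℂ)
      = (((p₁ * Q : ℕ+) : ℕ) : ℂ) * c k := by
  unfold profileDFT
  simp_rw [Finset.sum_mul]
  rw [Finset.sum_comm]
  have hinner : ∀ j : ZP p₁ Q,
      ∑ s : ZP p₁ Q, c j * (ZMod.stdAddChar (j * s) : ℂ) * (ZMod.stdAddChar (-(k * s)) : ℂ)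
        = c j * (if j - k = 0 then (((p₁ * Q : ℕ+) : ℕ) : ℂ) else 0) := by
    intro j
    have hs : ∀ s : ZP p₁ Q, c j * (ZMod.stdAddChar (j * s) : ℂ) * (ZMod.stdAddChar (-(k * s)) : ℂ)
        = c j * (ZMod.stdAddChar (s * (j - k)) : ℂ) := by
      intro s
      rw [mul_assoc, ← AddChar.map_add_eq_mul]
      congr 2
      ring
    simp_rw [hs]
    rw [← Finset.mul_sum, AddChar.sum_mulShift _ (ZMod.isPrimitive_stdAddChar _), ZMod.card, Nat.cast_ite,
      Nat.cast_zero]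
  simp_rw [hinner]
  rw [Finset.sum_eq_single k (fun j _ hj => by rw [if_neg (sub_ne_zero.2 hj), mul_zero])
    (fun h => absurd (Finset.mem_univ _) h)]
  rw [sub_self, if_pos rfl, mul_comm]

/-! ### The eigenvalue read at the offset -/

/-- The line ket takes the value `1` at its offset (`j = 0`, `ψ_P(0) = 1`; odd `P`, `b₀ = −1`).
[cite: ChenQuantumLattice2024, §3.5.9 p. 35] -/
theorem phi8bKet_apply_offset (b v' : Fin (n + 1) → ℤ) (hP : Odd ((p₁ * Q : ℕ+) : ℕ)) (hb : b 0 = -1) :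
    phi8bKet n D p₁ Q b v' (fun i => ((v' i : ℤ) : ZN D p₁ Q)) = 1 := by
  rw [← ptB_zero, phi8bKet_eq_profileKet, profileKet_apply_ptB n D p₁ Q b v' hP hb]
  have h0 : (-((0 : ZP p₁ Q) ^ 2) : ZP p₁ Q) = 0 := by ring
  show (ZMod.stdAddChar (-((0 : ZP p₁ Q) ^ 2)) : ℂ) = 1
  rw [h0]
  exact AddChar.map_zero_eq_one _

/-- THE EIGENVALUE A NON-DEMOLITION OPERATION REVEALS: `ndValue E b v′ = (E|φ_{b,v′}⟩)(v′ mod N)`; if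
`E|φ_{b,v′}⟩ = λ|φ_{b,v′}⟩` then `ndValue E b v′ = λ` (`ndValue_spec`). [folklore] -/
noncomputable def ndValue
    (E : Ket (n + 1) ((D * D * (p₁ * Q) : ℕ+) : ℕ) →ₗ[ℂ] Ket (n + 1) ((D * D * (p₁ * Q) : ℕ+) : ℕ))
    (b v' : Fin (n + 1) → ℤ) : ℂ :=
  E (phi8bKet n D p₁ Q b v') (fun i => ((v' i : ℤ) : ZN D p₁ Q))

/-- `ndValue` is the eigenvalue. [folklore] -/
theorem ndValue_spec
    {E : Ket (n + 1) ((D * D * (p₁ * Q) : ℕ+) : ℕ) →ₗ[ℂ] Ket (n + 1) ((D * D * (p₁ * Q) : ℕ+) : ℕ)}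
    {b v' : Fin (n + 1) → ℤ} (hP : Odd ((p₁ * Q : ℕ+) : ℕ)) (hb : b 0 = -1) {l : ℂ}
    (h : E (phi8bKet n D p₁ Q b v') = l • phi8bKet n D p₁ Q b v') : ndValue n D p₁ Q E b v' = l :=
  (eigenvalue_eq_apply h (phi8bKet_apply_offset n D p₁ Q b v' hP hb)).symm

/-- A non-demolition operation multiplies the line ket by `ndValue`. [folklore] -/
theorem IsNonDemolition.eq_smul
    {E : Ket (n + 1) ((D * D * (p₁ * Q) : ℕ+) : ℕ) →ₗ[ℂ] Ket (n + 1) ((D * D * (p₁ * Q) : ℕ+) : ℕ)}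
    {b v' : Fin (n + 1) → ℤ} (h : IsNonDemolition E (phi8bKet n D p₁ Q b v'))
    (hP : Odd ((p₁ * Q : ℕ+) : ℕ)) (hb : b 0 = -1) :
    E (phi8bKet n D p₁ Q b v') = ndValue n D p₁ Q E b v' • phi8bKet n D p₁ Q b v' := by
  obtain ⟨l, hl⟩ := h
  rw [ndValue_spec n D p₁ Q hP hb hl]
  exact hl

/-- The line ket depends on the offset only through `v′ mod N`. [folklore] -/
theorem phi8bKet_congr (b : Fin (n + 1) → ℤ) {v' v'' : Fin (n + 1) → ℤ}
    (h : ∀ i, ((v' i : ℤ) : ZN D p₁ Q) = ((v'' i : ℤ) : ZN D p₁ Q)) :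
    phi8bKet n D p₁ Q b v' = phi8bKet n D p₁ Q b v'' := by
  have hpt : ptB n D p₁ Q b v' = ptB n D p₁ Q b v'' := by
    funext j i
    simp only [ptB, Int.cast_add, h i]
  unfold phi8bKet
  rw [hpt]

/-- `ndValue` depends on the offset only through `v′ mod N`. [folklore] -/
theorem ndValue_congr
    (E : Ket (n + 1) ((D * D * (p₁ * Q) : ℕ+) : ℕ) →ₗ[ℂ] Ket (n + 1) ((D * D * (p₁ * Q) : ℕ+) : ℕ))
    (b : Fin (n + 1) → ℤ) {v' v'' : Fin (n + 1) → ℤ}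
    (h : ∀ i, ((v' i : ℤ) : ZN D p₁ Q) = ((v'' i : ℤ) : ZN D p₁ Q)) :
    ndValue n D p₁ Q E b v' = ndValue n D p₁ Q E b v'' := by
  unfold ndValue
  rw [phi8bKet_congr n D p₁ Q b h, show (fun i => ((v' i : ℤ) : ZN D p₁ Q))
    = fun i => ((v'' i : ℤ) : ZN D p₁ Q) from funext h]

open scoped Classical in
/-- The eigenvalue of the `M`-branch of a basis measurement is the outcome bit `[v′ mod N ∈ M]`.
[folklore] -/
theorem ndValue_branchOp (b v' : Fin (n + 1) → ℤ) (hP : Odd ((p₁ * Q : ℕ+) : ℕ)) (hb : b 0 = -1)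
    (M : Set (Fin (n + 1) → ZN D p₁ Q)) :
    ndValue n D p₁ Q (branchOp M) b v' = if (fun i => ((v' i : ℤ) : ZN D p₁ Q)) ∈ M then 1 else 0 := by
  unfold ndValue
  rw [branchOp_apply, Set.indicator_apply, phi8bKet_apply_offset n D p₁ Q b v' hP hb]

/-- The eigenvalues along the line through `v′`: `λ_{E,b,v′}(t) = ndValue E b (v′ − 2D²t·b)`, `t ∈ ℤ_P`.
[folklore] -/
noncomputable def evProfile
    (E : Ket (n + 1) ((D * D * (p₁ * Q) : ℕ+) : ℕ) →ₗ[ℂ] Ket (n + 1) ((D * D * (p₁ * Q) : ℕ+) : ℕ))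
    (b v' : Fin (n + 1) → ℤ) (t : ZP p₁ Q) : ℂ :=
  ndValue n D p₁ Q E b (lineShift n D b v' (-((t.val : ℕ) : ℤ)))

/-- `λ(0)` is the eigenvalue at `v′` itself. [folklore] -/
theorem evProfile_zero
    (E : Ket (n + 1) ((D * D * (p₁ * Q) : ℕ+) : ℕ) →ₗ[ℂ] Ket (n + 1) ((D * D * (p₁ * Q) : ℕ+) : ℕ))
    (b v' : Fin (n + 1) → ℤ) : evProfile n D p₁ Q E b v' 0 = ndValue n D p₁ Q E b v' := by
  simp only [evProfile, ZMod.val_zero, Nat.cast_zero, neg_zero, lineShift_zero]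

/-- `λ(t mod P) = ndValue E b (v′ − 2D²t·b)` for every integer `t`. [folklore] -/
theorem evProfile_intCast
    (E : Ket (n + 1) ((D * D * (p₁ * Q) : ℕ+) : ℕ) →ₗ[ℂ] Ket (n + 1) ((D * D * (p₁ * Q) : ℕ+) : ℕ))
    (b v' : Fin (n + 1) → ℤ) (t : ℤ) :
    evProfile n D p₁ Q E b v' ((t : ℤ) : ZP p₁ Q) = ndValue n D p₁ Q E b (lineShift n D b v' (-t)) := by
  unfold evProfile
  refine ndValue_congr n D p₁ Q E b (fun i => lineShift_cast_eq_of_modEq n D p₁ Q b v' ?_ i)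
  refine Int.ModEq.neg ?_
  rw [ZMod.val_intCast]
  exact Int.mod_modEq _ _

/-! ### Class-non-demolition operations: the eigenvalue is secret-independent and line-periodic -/

/-- `E` is a CLASS-NON-DEMOLITION operation: non-demolition on the line ket of every class secret `b`
(`b = bk` off `U`, `2p₁ ∣ b` on `U`, eq. (12)) and every offset `v′` — the operations a secret-ignorant
algorithm may apply to `|φ8.b⟩` knowing that the state survives.
[cite: ChenQuantumLattice2024, eq. (12) p. 17, §3.5.9 p. 35] -/
def IsClassND (U : Finset (Fin (n + 1))) (bk : Fin (n + 1) → ℤ)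
    (E : Ket (n + 1) ((D * D * (p₁ * Q) : ℕ+) : ℕ) →ₗ[ℂ] Ket (n + 1) ((D * D * (p₁ * Q) : ℕ+) : ℕ)) :
    Prop :=
  ∀ b, InClass n p₁ U bk b → ∀ v' : Fin (n + 1) → ℤ, IsNonDemolition E (phi8bKet n D p₁ Q b v')

/-- Coordinate `0` alone separates the parameters of two lines with `b₀ = b′₀ = −1` through the same
offset (odd `P`). [cite: ChenQuantumLattice2024, §3.5.9 p. 35, eq. (12) p. 17] -/
theorem eq_of_ptB_apply_zero_eq (hP : Odd ((p₁ * Q : ℕ+) : ℕ)) {b b' : Fin (n + 1) → ℤ}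
    (hb : b 0 = -1) (hb' : b' 0 = -1) (v' : Fin (n + 1) → ℤ) {i j : ZP p₁ Q}
    (h : ptB n D p₁ Q b v' i 0 = ptB n D p₁ Q b' v' j 0) : i = j := by
  have key : ptB 0 D p₁ Q (fun _ => (-1 : ℤ)) (fun _ => v' 0) i
      = ptB 0 D p₁ Q (fun _ => (-1 : ℤ)) (fun _ => v' 0) j := by
    funext l
    simp only [ptB] at h ⊢
    rw [hb, hb'] at h
    exact h
  exact ptB_injective 0 D p₁ Q _ _ hP rfl key

section ClassND

variable {n D p₁ Q}
variable {U : Finset (Fin (n + 1))} {bk : Fin (n + 1) → ℤ}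
variable {E : Ket (n + 1) ((D * D * (p₁ * Q) : ℕ+) : ℕ) →ₗ[ℂ] Ket (n + 1) ((D * D * (p₁ * Q) : ℕ+) : ℕ)}

/-- Under `IsClassND` the expansion of `P·E|v′⟩` runs along the line of any class secret `b`, with the
eigenvalue profile `λ_{E,b,v′}`. [cite: ChenQuantumLattice2024, §3.5.9 p. 35; folklore] -/
theorem IsClassND.expansion (hE : IsClassND n D p₁ Q U bk E) (hP : Odd ((p₁ * Q : ℕ+) : ℕ))
    (hU : (0 : Fin (n + 1)) ∉ U) (hbk0 : bk 0 = -1) {b : Fin (n + 1) → ℤ} (hb : InClass n p₁ U bk b)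
    (v' : Fin (n + 1) → ℤ) :
    (((p₁ * Q : ℕ+) : ℕ) : ℂ) • E (basisKet fun i => ((v' i : ℤ) : ZN D p₁ Q))
      = lineKet (ptB n D p₁ Q b v') (fun j => (ZMod.stdAddChar (-(j ^ 2) : ZP p₁ Q) : ℂ)
          * profileDFT p₁ Q (evProfile n D p₁ Q E b v') (-(2 * j))) :=
  nd_expansion n D p₁ Q hP b v' E _
    (fun _ => (hE b hb _).eq_smul n D p₁ Q hP (InClass.apply_zero n p₁ hU hbk0 hb))

/-- **Two class secrets expand the same vector.**  The line profiles `F_b(i) = ψ_P(−i²)·λ̂_b(−2i)` of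
`P·E|v′⟩` along the lines of `b` and `b′` satisfy `F_b(i) = [2D²i·b + v′ ≡ 2D²i·b′ + v′]·F_{b′}(i)`.
[cite: ChenQuantumLattice2024, §3.5.9 p. 35; folklore] -/
theorem IsClassND.lineProfile_eq_ite (hE : IsClassND n D p₁ Q U bk E) (hP : Odd ((p₁ * Q : ℕ+) : ℕ))
    (hU : (0 : Fin (n + 1)) ∉ U) (hbk0 : bk 0 = -1) {b b' : Fin (n + 1) → ℤ}
    (hb : InClass n p₁ U bk b) (hb' : InClass n p₁ U bk b') (v' : Fin (n + 1) → ℤ) (i : ZP p₁ Q) :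
    (ZMod.stdAddChar (-(i ^ 2) : ZP p₁ Q) : ℂ) * profileDFT p₁ Q (evProfile n D p₁ Q E b v') (-(2 * i))
      = if ptB n D p₁ Q b v' i = ptB n D p₁ Q b' v' i
        then (ZMod.stdAddChar (-(i ^ 2) : ZP p₁ Q) : ℂ)
          * profileDFT p₁ Q (evProfile n D p₁ Q E b' v') (-(2 * i))
        else 0 := by
  have hb0 := InClass.apply_zero n p₁ hU hbk0 hb
  have hb0' := InClass.apply_zero n p₁ hU hbk0 hb'
  have e := (hE.expansion hP hU hbk0 hb v').symm.trans (hE.expansion hP hU hbk0 hb' v')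
  have ev := congrFun e (ptB n D p₁ Q b v' i)
  rw [lineKet_apply_pt (ptB_injective n D p₁ Q b v' hP hb0)] at ev
  rw [ev]
  by_cases hmeet : ptB n D p₁ Q b v' i = ptB n D p₁ Q b' v' i
  · rw [if_pos hmeet, hmeet, lineKet_apply_pt (ptB_injective n D p₁ Q b' v' hP hb0')]
  · rw [if_neg hmeet]
    refine lineKet_apply_of_ne _ _ fun j hj => ?_
    have hij : i = j := eq_of_ptB_apply_zero_eq n D p₁ Q hP hb0 hb0' v' (congrFun hj 0)
    subst hij
    exact hmeet hj

/-- The Fourier transform of the eigenvalue profile does not depend on the class secret.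
[cite: ChenQuantumLattice2024, §3.5.9 p. 35; folklore] -/
theorem IsClassND.profileDFT_evProfile_indep (hE : IsClassND n D p₁ Q U bk E)
    (hP : Odd ((p₁ * Q : ℕ+) : ℕ)) (hU : (0 : Fin (n + 1)) ∉ U) (hbk0 : bk 0 = -1)
    {b b' : Fin (n + 1) → ℤ} (hb : InClass n p₁ U bk b) (hb' : InClass n p₁ U bk b')
    (v' : Fin (n + 1) → ℤ) (s : ZP p₁ Q) :
    profileDFT p₁ Q (evProfile n D p₁ Q E b v') s = profileDFT p₁ Q (evProfile n D p₁ Q E b' v') s := by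
  obtain ⟨w, hw⟩ := (Literature.NumberTheory.GaussSums.isUnit_two_zmod_of_odd _ hP).exists_right_inv
  set i : ZP p₁ Q := -(s * w) with hi_def
  have hs : -(2 * i) = s := by rw [hi_def]; linear_combination s * hw
  have h1 := hE.lineProfile_eq_ite hP hU hbk0 hb hb' v' i
  have h2 := hE.lineProfile_eq_ite hP hU hbk0 hb' hb v' i
  have hF : (ZMod.stdAddChar (-(i ^ 2) : ZP p₁ Q) : ℂ) * profileDFT p₁ Q (evProfile n D p₁ Q E b v') (-(2 * i))
      = (ZMod.stdAddChar (-(i ^ 2) : ZP p₁ Q) : ℂ)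
          * profileDFT p₁ Q (evProfile n D p₁ Q E b' v') (-(2 * i)) := by
    by_cases hmeet : ptB n D p₁ Q b v' i = ptB n D p₁ Q b' v' i
    · rw [h1, if_pos hmeet]
    · rw [h1, if_neg hmeet, h2, if_neg (Ne.symm hmeet)]
  rw [← hs]
  exact mul_left_cancel₀ (chirp_ne_zero p₁ Q i) hF

/-- The eigenvalue profile does not depend on the class secret. [cite: ChenQuantumLattice2024, §3.5.9 p. 35; folklore] -/
theorem IsClassND.evProfile_indep (hE : IsClassND n D p₁ Q U bk E) (hP : Odd ((p₁ * Q : ℕ+) : ℕ))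
    (hU : (0 : Fin (n + 1)) ∉ U) (hbk0 : bk 0 = -1) {b b' : Fin (n + 1) → ℤ}
    (hb : InClass n p₁ U bk b) (hb' : InClass n p₁ U bk b') (v' : Fin (n + 1) → ℤ) (t : ZP p₁ Q) :
    evProfile n D p₁ Q E b v' t = evProfile n D p₁ Q E b' v' t := by
  have hPne : (((p₁ * Q : ℕ+) : ℕ) : ℂ) ≠ 0 := Nat.cast_ne_zero.2 (PNat.ne_zero _)
  have h := profileDFT_inversion p₁ Q (evProfile n D p₁ Q E b v') t
  have h' := profileDFT_inversion p₁ Q (evProfile n D p₁ Q E b' v') t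
  simp_rw [hE.profileDFT_evProfile_indep hP hU hbk0 hb hb' v'] at h
  exact mul_left_cancel₀ hPne (h.symm.trans h')

/-- **Secret independence of the eigenvalue.**  A class-non-demolition operation has the same eigenvalue
on `|φ_{b,v′}⟩` for every class secret `b` (odd `P`, `0 ∉ U`, `bk₀ = −1`).
[cite: ChenQuantumLattice2024, §3.5.9 p. 35, eq. (12) p. 17] -/
theorem IsClassND.ndValue_secret_indep (hE : IsClassND n D p₁ Q U bk E) (hP : Odd ((p₁ * Q : ℕ+) : ℕ))
    (hU : (0 : Fin (n + 1)) ∉ U) (hbk0 : bk 0 = -1) {b b' : Fin (n + 1) → ℤ}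
    (hb : InClass n p₁ U bk b) (hb' : InClass n p₁ U bk b') (v' : Fin (n + 1) → ℤ) :
    ndValue n D p₁ Q E b v' = ndValue n D p₁ Q E b' v' := by
  rw [← evProfile_zero, ← evProfile_zero n D p₁ Q E b' v']
  exact hE.evProfile_indep hP hU hbk0 hb hb' v' 0

/-- The class secret with coordinate `i₀` raised by `2p₁`. [cite: ChenQuantumLattice2024, eq. (12) p. 17] -/
def bump (b : Fin (n + 1) → ℤ) (i₀ : Fin (n + 1)) : Fin (n + 1) → ℤ :=
  Function.update b i₀ (b i₀ + 2 * ((p₁ : ℕ) : ℤ))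

/-- Bumping an unknown coordinate stays in the class. [cite: ChenQuantumLattice2024, eq. (12) p. 17] -/
theorem InClass.bump {b : Fin (n + 1) → ℤ} (hb : InClass n p₁ U bk b) {i₀ : Fin (n + 1)} (hi₀ : i₀ ∈ U) :
    InClass n p₁ U bk (bump (p₁ := p₁) b i₀) := by
  refine ⟨fun i hi => ?_, fun i hi => ?_⟩
  · have hne : i ≠ i₀ := fun h => hi (h ▸ hi₀)
    rw [Chen2024.bump, Function.update_of_ne hne]
    exact hb.1 i hi
  · by_cases h : i = i₀
    · subst h
      rw [Chen2024.bump, Function.update_self]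
      exact dvd_add (hb.2 i hi) (dvd_refl _)
    · rw [Chen2024.bump, Function.update_of_ne h]
      exact hb.2 i hi

/-- The lines of `b` and of its bump through the same offset meet only at parameters `≡ 0 (mod Q)`
(odd `Q`). [cite: ChenQuantumLattice2024, §3.5.9 p. 35] -/
theorem toQ_eq_zero_of_ptB_eq_ptB_bump (hQ : Odd ((Q : ℕ+) : ℕ)) {b : Fin (n + 1) → ℤ} {i₀ : Fin (n + 1)}
    (v' : Fin (n + 1) → ℤ) {i : ZP p₁ Q}
    (h : ptB n D p₁ Q b v' i = ptB n D p₁ Q (bump (p₁ := p₁) b i₀) v' i) : toQ p₁ Q i = 0 := by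
  have hi := congrFun h i₀
  simp only [ptB, bump, Function.update_self] at hi
  rw [ZMod.intCast_eq_intCast_iff_dvd_sub] at hi
  have e1 : (2 * ((D : ℕ) : ℤ) ^ 2 * ((i.val : ℕ) : ℤ) * (b i₀ + 2 * ((p₁ : ℕ) : ℤ)) + v' i₀)
        - (2 * ((D : ℕ) : ℤ) ^ 2 * ((i.val : ℕ) : ℤ) * b i₀ + v' i₀)
      = (((D : ℕ) : ℤ) * ((D : ℕ) : ℤ) * ((p₁ : ℕ) : ℤ)) * (((4 * i.val : ℕ)) : ℤ) := by push_cast; ring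
  have e2 : (((D * D * (p₁ * Q) : ℕ+) : ℕ) : ℤ)
      = (((D : ℕ) : ℤ) * ((D : ℕ) : ℤ) * ((p₁ : ℕ) : ℤ)) * ((Q : ℕ) : ℤ) := by push_cast; ring
  rw [e1, e2] at hi
  have hne : ((D : ℕ) : ℤ) * ((D : ℕ) : ℤ) * ((p₁ : ℕ) : ℤ) ≠ 0 := by positivity
  have hQ4 : ((Q : ℕ) : ℤ) ∣ ((4 * i.val : ℕ) : ℤ) := (mul_dvd_mul_iff_left hne).1 hi
  have hQ4' : (Q : ℕ) ∣ 4 * i.val := Int.natCast_dvd_natCast.1 hQ4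
  have h4 : Nat.Coprime (Q : ℕ) 4 := by
    have h2 : Nat.Coprime (Q : ℕ) 2 := Nat.coprime_two_right.2 hQ
    simpa using h2.pow_right 2
  have hQi : (Q : ℕ) ∣ i.val := h4.dvd_of_dvd_mul_left hQ4'
  rw [toQ, ZMod.castHom_apply, ZMod.cast_eq_val]
  exact (ZMod.natCast_eq_zero_iff _ _).2 hQi

/-- `λ̂_b` vanishes off the multiples of `Q` (compare `b` with its bump at some `i₀ ∈ U`).
[cite: ChenQuantumLattice2024, §3.5.9 p. 35, eq. (12) p. 17] -/
theorem IsClassND.profileDFT_evProfile_eq_zero (hE : IsClassND n D p₁ Q U bk E)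
    (hP : Odd ((p₁ * Q : ℕ+) : ℕ)) (hQ : Odd ((Q : ℕ+) : ℕ)) (hU : (0 : Fin (n + 1)) ∉ U)
    (hbk0 : bk 0 = -1) {b : Fin (n + 1) → ℤ} (hb : InClass n p₁ U bk b) {i₀ : Fin (n + 1)}
    (hi₀ : i₀ ∈ U) (v' : Fin (n + 1) → ℤ) {s : ZP p₁ Q} (hs : toQ p₁ Q s ≠ 0) :
    profileDFT p₁ Q (evProfile n D p₁ Q E b v') s = 0 := by
  obtain ⟨w, hw⟩ := (Literature.NumberTheory.GaussSums.isUnit_two_zmod_of_odd _ hP).exists_right_inv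
  set i : ZP p₁ Q := -(s * w) with hi_def
  have hsi : -(2 * i) = s := by rw [hi_def]; linear_combination s * hw
  have hti : toQ p₁ Q i ≠ 0 := by
    intro h0
    apply hs
    rw [← hsi, map_neg, map_mul, h0, mul_zero, neg_zero]
  have h1 := hE.lineProfile_eq_ite hP hU hbk0 hb (hb.bump hi₀) v' i
  have hmeet : ptB n D p₁ Q b v' i ≠ ptB n D p₁ Q (bump (p₁ := p₁) b i₀) v' i :=
    fun h => hti (toQ_eq_zero_of_ptB_eq_ptB_bump hQ v' h)
  rw [if_neg hmeet] at h1
  rw [← hsi]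
  exact (mul_eq_zero.1 h1).resolve_left (chirp_ne_zero p₁ Q i)

/-- The eigenvalue profile has period `p₁`. [cite: ChenQuantumLattice2024, §3.5.9 p. 35, eq. (12) p. 17] -/
theorem IsClassND.evProfile_periodic (hE : IsClassND n D p₁ Q U bk E) (hP : Odd ((p₁ * Q : ℕ+) : ℕ))
    (hQ : Odd ((Q : ℕ+) : ℕ)) (hU : (0 : Fin (n + 1)) ∉ U) (hbk0 : bk 0 = -1) {b : Fin (n + 1) → ℤ}
    (hb : InClass n p₁ U bk b) {i₀ : Fin (n + 1)} (hi₀ : i₀ ∈ U) (v' : Fin (n + 1) → ℤ) (k : ZP p₁ Q) :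
    evProfile n D p₁ Q E b v' (k + ((p₁ : ℕ) : ZP p₁ Q)) = evProfile n D p₁ Q E b v' k := by
  have hPne : (((p₁ * Q : ℕ+) : ℕ) : ℂ) ≠ 0 := Nat.cast_ne_zero.2 (PNat.ne_zero _)
  have h := profileDFT_inversion p₁ Q (evProfile n D p₁ Q E b v') (k + ((p₁ : ℕ) : ZP p₁ Q))
  have h' := profileDFT_inversion p₁ Q (evProfile n D p₁ Q E b v') k
  have hterms : ∀ s : ZP p₁ Q,
      profileDFT p₁ Q (evProfile n D p₁ Q E b v') s
          * (ZMod.stdAddChar (-((k + ((p₁ : ℕ) : ZP p₁ Q)) * s)) : ℂ)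
        = profileDFT p₁ Q (evProfile n D p₁ Q E b v') s * (ZMod.stdAddChar (-(k * s)) : ℂ) := by
    intro s
    by_cases hs : toQ p₁ Q s = 0
    · obtain ⟨y, rfl⟩ := exists_eq_Q_mul_of_toQ_eq_zero p₁ Q hs
      have hz := p₁_mul_Q_eq_zero p₁ Q
      have harg : (-((k + ((p₁ : ℕ) : ZP p₁ Q)) * (((Q : ℕ) : ZP p₁ Q) * y)) : ZP p₁ Q)
          = -(k * (((Q : ℕ) : ZP p₁ Q) * y)) := by
        linear_combination (-y) * hz
      rw [harg]
    · rw [hE.profileDFT_evProfile_eq_zero hP hQ hU hbk0 hb hi₀ v' hs, zero_mul, zero_mul]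
  simp_rw [hterms] at h
  exact (mul_left_cancel₀ hPne (h.symm.trans h')).symm ▸ rfl

/-- **Line periodicity of the eigenvalue**: moving the offset `p₁` further steps along the line does not
change it (odd `P`, odd `Q`, `0 ∉ U`, `bk₀ = −1`, some unknown coordinate `i₀ ∈ U`).
[cite: ChenQuantumLattice2024, §3.5.9 p. 35, eq. (12) p. 17] -/
theorem IsClassND.ndValue_lineShift_add_p₁ (hE : IsClassND n D p₁ Q U bk E)
    (hP : Odd ((p₁ * Q : ℕ+) : ℕ)) (hQ : Odd ((Q : ℕ+) : ℕ)) (hU : (0 : Fin (n + 1)) ∉ U)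
    (hbk0 : bk 0 = -1) {b : Fin (n + 1) → ℤ} (hb : InClass n p₁ U bk b) {i₀ : Fin (n + 1)}
    (hi₀ : i₀ ∈ U) (v' : Fin (n + 1) → ℤ) (t : ℤ) :
    ndValue n D p₁ Q E b (lineShift n D b v' (t + ((p₁ : ℕ) : ℤ)))
      = ndValue n D p₁ Q E b (lineShift n D b v' t) := by
  have h := hE.evProfile_periodic hP hQ hU hbk0 hb hi₀ v' (((-(t + ((p₁ : ℕ) : ℤ)) : ℤ) : ZP p₁ Q))
  have e : ((-(t + ((p₁ : ℕ) : ℤ)) : ℤ) : ZP p₁ Q) + ((p₁ : ℕ) : ZP p₁ Q) = ((-t : ℤ) : ZP p₁ Q) := by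
    push_cast; ring
  rw [e, evProfile_intCast, evProfile_intCast, neg_neg, neg_neg] at h
  exact h.symm

/-- The offset may move any multiple of `p₁` steps along the line.
[cite: ChenQuantumLattice2024, §3.5.9 p. 35, eq. (12) p. 17] -/
theorem IsClassND.ndValue_lineShift_p₁_mul (hE : IsClassND n D p₁ Q U bk E)
    (hP : Odd ((p₁ * Q : ℕ+) : ℕ)) (hQ : Odd ((Q : ℕ+) : ℕ)) (hU : (0 : Fin (n + 1)) ∉ U)
    (hbk0 : bk 0 = -1) {b : Fin (n + 1) → ℤ} (hb : InClass n p₁ U bk b) {i₀ : Fin (n + 1)}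
    (hi₀ : i₀ ∈ U) (v' : Fin (n + 1) → ℤ) (m : ℤ) :
    ndValue n D p₁ Q E b (lineShift n D b v' (((p₁ : ℕ) : ℤ) * m)) = ndValue n D p₁ Q E b v' := by
  induction m using Int.induction_on with
  | zero => rw [mul_zero, lineShift_zero]
  | succ m ih =>
      rw [mul_add, mul_one, hE.ndValue_lineShift_add_p₁ hP hQ hU hbk0 hb hi₀ v' _, ih]
  | pred m ih =>
      have h := hE.ndValue_lineShift_add_p₁ hP hQ hU hbk0 hb hi₀ v' (((p₁ : ℕ) : ℤ) * (-(m : ℤ) - 1))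
      rw [show ((p₁ : ℕ) : ℤ) * (-(m : ℤ) - 1) + ((p₁ : ℕ) : ℤ) = ((p₁ : ℕ) : ℤ) * (-(m : ℤ)) by ring]
        at h
      rw [← ih, ← h]

/-! ### Class-shift blindness of the eigenvalue -/

/-- Moving `−t` steps along `b` and `t` steps along its bump at `i₀` adds `4D²p₁t·𝟙_{i₀}` to the offset.
[folklore] -/
theorem lineShift_bump (b v' : Fin (n + 1) → ℤ) (i₀ : Fin (n + 1)) (t : ℤ) :
    lineShift n D (bump (p₁ := p₁) b i₀) (lineShift n D b v' (-t)) t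
      = fun i => v' i + if i = i₀ then ((D : ℕ) : ℤ) ^ 2 * ((p₁ : ℕ) : ℤ) * (4 * t) else 0 := by
  funext i
  by_cases h : i = i₀
  · subst h
    simp only [lineShift, bump, Function.update_self, if_true]
    ring
  · simp only [lineShift, bump, Function.update_of_ne h, if_neg h]
    ring

/-- **One unknown coordinate of the offset may move by any multiple of `D²p₁`** (odd `P`, odd `Q`,
`gcd(p₁,Q) = 1`, `0 ∉ U`, `bk₀ = −1`, `i₀ ∈ U`). [cite: ChenQuantumLattice2024, §3.5.9 p. 35, eq. (12) p. 17] -/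
theorem IsClassND.ndValue_add_single (hE : IsClassND n D p₁ Q U bk E) (hP : Odd ((p₁ * Q : ℕ+) : ℕ))
    (hQ : Odd ((Q : ℕ+) : ℕ)) (hpQ : Nat.Coprime (p₁ : ℕ) (Q : ℕ)) (hU : (0 : Fin (n + 1)) ∉ U)
    (hbk0 : bk 0 = -1) {b : Fin (n + 1) → ℤ} (hb : InClass n p₁ U bk b) {i₀ : Fin (n + 1)}
    (hi₀ : i₀ ∈ U) (v' : Fin (n + 1) → ℤ) (r : ℤ) :
    ndValue n D p₁ Q E b (fun i => v' i + if i = i₀ then ((D : ℕ) : ℤ) ^ 2 * ((p₁ : ℕ) : ℤ) * r else 0)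
      = ndValue n D p₁ Q E b v' := by
  -- choose `m` with `4p₁m ≡ r (mod Q)`
  obtain ⟨m, hm⟩ : ∃ m : ℤ, r ≡ 4 * (((p₁ : ℕ) : ℤ) * m) [ZMOD (((Q : ℕ+) : ℕ) : ℤ)] := by
    have h4 : Nat.Coprime 4 (Q : ℕ) := by
      have h2 : Nat.Coprime 2 (Q : ℕ) := Nat.coprime_two_left.2 hQ
      simpa using h2.pow_left 2
    have hunit : IsUnit (((4 * (p₁ : ℕ) : ℕ)) : ZQ Q) :=
      (ZMod.isUnit_iff_coprime _ _).2 (Nat.Coprime.mul_left h4 hpQ)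
    obtain ⟨u, hu⟩ := hunit.exists_right_inv
    obtain ⟨m, hm⟩ := ZMod.intCast_surjective (u * ((r : ℤ) : ZQ Q))
    refine ⟨m, ?_⟩
    have hu' : (4 : ZQ Q) * ((p₁ : ℕ) : ZQ Q) * u = 1 := by rw [← hu]; push_cast; ring
    have h0 : (((4 * (((p₁ : ℕ) : ℤ) * m) - r : ℤ)) : ZQ Q) = 0 := by
      push_cast
      rw [hm]
      linear_combination ((r : ℤ) : ZQ Q) * hu'
    exact Int.modEq_iff_dvd.2 ((ZMod.intCast_zmod_eq_zero_iff_dvd _ _).1 h0)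
  have hb' : InClass n p₁ U bk (bump (p₁ := p₁) b i₀) := hb.bump hi₀
  have hcast : ∀ i,
      (((v' i + if i = i₀ then ((D : ℕ) : ℤ) ^ 2 * ((p₁ : ℕ) : ℤ) * r else 0 : ℤ)) : ZN D p₁ Q)
        = (((v' i + if i = i₀ then ((D : ℕ) : ℤ) ^ 2 * ((p₁ : ℕ) : ℤ) * (4 * (((p₁ : ℕ) : ℤ) * m)) else 0
            : ℤ)) : ZN D p₁ Q) := by
    intro i
    by_cases h : i = i₀
    · rw [if_pos h, if_pos h, Int.cast_add, Int.cast_add, Dsq_p₁_mul_eq_of_modEq D p₁ Q hm]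
    · rw [if_neg h, if_neg h]
  calc ndValue n D p₁ Q E b (fun i => v' i + if i = i₀ then ((D : ℕ) : ℤ) ^ 2 * ((p₁ : ℕ) : ℤ) * r else 0)
      = ndValue n D p₁ Q E b
          (lineShift n D (bump (p₁ := p₁) b i₀) (lineShift n D b v' (-(((p₁ : ℕ) : ℤ) * m)))
            (((p₁ : ℕ) : ℤ) * m)) := by
        rw [lineShift_bump]
        exact ndValue_congr n D p₁ Q E b hcast
    _ = ndValue n D p₁ Q E (bump (p₁ := p₁) b i₀)
          (lineShift n D (bump (p₁ := p₁) b i₀) (lineShift n D b v' (-(((p₁ : ℕ) : ℤ) * m)))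
            (((p₁ : ℕ) : ℤ) * m)) := hE.ndValue_secret_indep hP hU hbk0 hb hb' _
    _ = ndValue n D p₁ Q E (bump (p₁ := p₁) b i₀) (lineShift n D b v' (-(((p₁ : ℕ) : ℤ) * m))) :=
        hE.ndValue_lineShift_p₁_mul hP hQ hU hbk0 hb' hi₀ _ m
    _ = ndValue n D p₁ Q E b (lineShift n D b v' (-(((p₁ : ℕ) : ℤ) * m))) :=
        (hE.ndValue_secret_indep hP hU hbk0 hb hb' _).symm
    _ = ndValue n D p₁ Q E b (lineShift n D b v' (((p₁ : ℕ) : ℤ) * (-m))) := by rw [mul_neg]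
    _ = ndValue n D p₁ Q E b v' := hE.ndValue_lineShift_p₁_mul hP hQ hU hbk0 hb hi₀ v' (-m)

/-- The unknown coordinates of the offset may move by any multiples of `D²p₁`.
[cite: ChenQuantumLattice2024, §3.5.9 p. 35, eq. (12) p. 17] -/
theorem IsClassND.ndValue_add_on (hE : IsClassND n D p₁ Q U bk E) (hP : Odd ((p₁ * Q : ℕ+) : ℕ))
    (hQ : Odd ((Q : ℕ+) : ℕ)) (hpQ : Nat.Coprime (p₁ : ℕ) (Q : ℕ)) (hU : (0 : Fin (n + 1)) ∉ U)
    (hbk0 : bk 0 = -1) {b : Fin (n + 1) → ℤ} (hb : InClass n p₁ U bk b) (v' r : Fin (n + 1) → ℤ)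
    (S : Finset (Fin (n + 1))) (hS : S ⊆ U) :
    ndValue n D p₁ Q E b (fun i => v' i + if i ∈ S then ((D : ℕ) : ℤ) ^ 2 * ((p₁ : ℕ) : ℤ) * r i else 0)
      = ndValue n D p₁ Q E b v' := by
  revert hS
  refine Finset.induction_on S ?_ ?_
  · intro _
    simp only [Finset.notMem_empty, if_false, add_zero]
  · intro j S hj ih hS
    have hjU : j ∈ U := hS (Finset.mem_insert_self j S)
    have hSU : S ⊆ U := fun i hi => hS (Finset.mem_insert_of_mem hi)
    have hsplit : (fun i => v' i + if i ∈ insert j S then ((D : ℕ) : ℤ) ^ 2 * ((p₁ : ℕ) : ℤ) * r i else 0)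
        = fun i => (v' i + if i ∈ S then ((D : ℕ) : ℤ) ^ 2 * ((p₁ : ℕ) : ℤ) * r i else 0)
            + if i = j then ((D : ℕ) : ℤ) ^ 2 * ((p₁ : ℕ) : ℤ) * r j else 0 := by
      funext i
      by_cases hij : i = j
      · subst hij
        simp [hj]
      · simp [Finset.mem_insert, hij]
    rw [hsplit, hE.ndValue_add_single hP hQ hpQ hU hbk0 hb hjU _ (r j), ih hSU]

/-- **Class-shift blindness.**  The eigenvalue of a class-non-demolition operation is the same at `v′` and
at every class-shifted offset `v′ + D²p₁(a·bk + c·𝟙_U)` (odd `P`, odd `Q`, `gcd(p₁,Q) = 1`, `0 ∉ U ≠ ∅`,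
`bk₀ = −1`). [cite: ChenQuantumLattice2024, §3.5.9 p. 35, Claim 3.14 pp. 33–34, eq. (12) p. 17] -/
theorem IsClassND.ndValue_classShift (hE : IsClassND n D p₁ Q U bk E) (hP : Odd ((p₁ * Q : ℕ+) : ℕ))
    (hQ : Odd ((Q : ℕ+) : ℕ)) (hpQ : Nat.Coprime (p₁ : ℕ) (Q : ℕ)) (hU : (0 : Fin (n + 1)) ∉ U)
    (hU' : U.Nonempty) (hbk0 : bk 0 = -1) {b : Fin (n + 1) → ℤ} (hb : InClass n p₁ U bk b)
    (v' : Fin (n + 1) → ℤ) (a : ZQ Q) (c : Fin (n + 1) → ZQ Q) :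
    ndValue n D p₁ Q E b (fun i => v' i + classShift n D p₁ Q U bk a c i) = ndValue n D p₁ Q E b v' := by
  obtain ⟨i₀, hi₀⟩ := hU'
  -- `a ≡ 2m₀ (mod Q)`
  obtain ⟨m₀, hm₀⟩ : ∃ m₀ : ℤ, ((a.val : ℕ) : ℤ) ≡ 2 * m₀ [ZMOD (((Q : ℕ+) : ℕ) : ℤ)] := by
    obtain ⟨k, hk⟩ := id hQ
    have hk' : (((Q : ℕ+) : ℕ) : ℤ) = 2 * (k : ℤ) + 1 := by rw [hk]; push_cast; ring
    refine ⟨((a.val : ℕ) : ℤ) * ((k : ℤ) + 1), Int.modEq_iff_dvd.2 ⟨((a.val : ℕ) : ℤ), ?_⟩⟩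
    rw [hk']
    ring
  -- split the class shift into a move along the line and per-coordinate multiples of `D²p₁`
  let r : Fin (n + 1) → ℤ := fun i => ((a.val : ℕ) : ℤ) * bk i + ((classTail n Q U c i : ℕ) : ℤ) - 2 * m₀ * b i
  have hsplit : (fun i => v' i + classShift n D p₁ Q U bk a c i)
      = lineShift n D b (fun i => v' i + ((D : ℕ) : ℤ) ^ 2 * ((p₁ : ℕ) : ℤ) * r i) (((p₁ : ℕ) : ℤ) * m₀) := by
    funext i
    simp only [lineShift, classShift, r]
    ring
  have hoff : ∀ i, i ∉ U → r i ≡ 0 [ZMOD (((Q : ℕ+) : ℕ) : ℤ)] := by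
    intro i hi
    have e : r i = (((a.val : ℕ) : ℤ) - 2 * m₀) * bk i := by
      simp only [r, classTail, if_neg hi, hb.1 i hi]
      push_cast
      ring
    rw [e]
    have h := (hm₀.sub_right (2 * m₀)).mul_right (bk i)
    rwa [sub_self, zero_mul] at h
  have hcast : ∀ i, (((v' i + ((D : ℕ) : ℤ) ^ 2 * ((p₁ : ℕ) : ℤ) * r i : ℤ)) : ZN D p₁ Q)
      = (((v' i + if i ∈ U then ((D : ℕ) : ℤ) ^ 2 * ((p₁ : ℕ) : ℤ) * r i else 0 : ℤ)) : ZN D p₁ Q) := by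
    intro i
    by_cases hi : i ∈ U
    · rw [if_pos hi]
    · rw [if_neg hi, Int.cast_add, Int.cast_add, Dsq_p₁_mul_eq_of_modEq D p₁ Q (hoff i hi)]
      simp
  rw [hsplit, hE.ndValue_lineShift_p₁_mul hP hQ hU hbk0 hb hi₀ _ m₀,
    ndValue_congr n D p₁ Q E b (v' := fun i => v' i + ((D : ℕ) : ℤ) ^ 2 * ((p₁ : ℕ) : ℤ) * r i)
      (v'' := fun i => v' i + if i ∈ U then ((D : ℕ) : ℤ) ^ 2 * ((p₁ : ℕ) : ℤ) * r i else 0) hcast]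
  exact hE.ndValue_add_on hP hQ hpQ hU hbk0 hb v' r U (subset_refl U)

/-- **T4 for arbitrary non-demolition operations: the eigenvalue is class-blind.**  For odd `P`, odd `Q`,
`gcd(p₁,Q) = 1`, `0 ∉ U ≠ ∅`, `bk₀ = −1`: a class-non-demolition operation `E` has the same eigenvalue on
`|φ_{b,v′}⟩` and on `|φ_{b′,v′+d(a,c)}⟩` for all class secrets `b, b′` and all class shifts `d(a,c)` — the
secret-free information it offers cannot tell the offsets of the residual class apart, hence cannot
supply the centre correction (`ChenQuantumLWEClassTwirl`, `ChenQuantumLWELineInvariants`).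
[cite: ChenQuantumLattice2024, §3.5.9 pp. 34–38, Claim 3.14 pp. 33–34, eq. (12) p. 17] -/
theorem IsClassND.ndValue_class_blind (hE : IsClassND n D p₁ Q U bk E) (hP : Odd ((p₁ * Q : ℕ+) : ℕ))
    (hQ : Odd ((Q : ℕ+) : ℕ)) (hpQ : Nat.Coprime (p₁ : ℕ) (Q : ℕ)) (hU : (0 : Fin (n + 1)) ∉ U)
    (hU' : U.Nonempty) (hbk0 : bk 0 = -1) {b b' : Fin (n + 1) → ℤ} (hb : InClass n p₁ U bk b)
    (hb' : InClass n p₁ U bk b') (v' : Fin (n + 1) → ℤ) (a : ZQ Q) (c : Fin (n + 1) → ZQ Q) :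
    ndValue n D p₁ Q E b v' = ndValue n D p₁ Q E b' (fun i => v' i + classShift n D p₁ Q U bk a c i) := by
  rw [hE.ndValue_classShift hP hQ hpQ hU hU' hbk0 hb' v' a c]
  exact hE.ndValue_secret_indep hP hU hbk0 hb hb' v'

end ClassND

/-! ### Sharpness: the Step-8 datum is the eigenvalue of a public stabilising operation -/

/-- `p₁ ∣ P`. [folklore] -/
theorem p₁_dvd_p₁Q : ((p₁ : ℕ+) : ℕ) ∣ ((p₁ * Q : ℕ+) : ℕ) := ⟨Q, by rw [PNat.mul_coe]⟩

/-- The reduction `ℤ_P →+* ℤ_{p₁}`. [folklore] -/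
def toPp₁ : ZP p₁ Q →+* ZMod ((p₁ : ℕ+) : ℕ) := ZMod.castHom (p₁_dvd_p₁Q p₁ Q) (ZMod ((p₁ : ℕ+) : ℕ))

/-- `toPp₁ x = x.val mod p₁`. [folklore] -/
theorem toPp₁_eq_natCast_val (x : ZP p₁ Q) : toPp₁ p₁ Q x = ((x.val : ℕ) : ZMod ((p₁ : ℕ+) : ℕ)) := by
  rw [toPp₁, ZMod.castHom_apply, ZMod.cast_eq_val]

/-- **Third two-modulus identity.** `ψ_P(Q·x) = ψ_{p₁}(x mod p₁)` for `P = p₁Q`. [folklore] -/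
theorem stdAddChar_Q_mul (x : ZP p₁ Q) :
    (ZMod.stdAddChar (((Q : ℕ) : ZP p₁ Q) * x) : ℂ) = ZMod.stdAddChar (toPp₁ p₁ Q x) := by
  obtain ⟨t, rfl⟩ : ∃ t : ℕ, (t : ZP p₁ Q) = x := ⟨x.val, ZMod.natCast_zmod_val x⟩
  have h1 : ((Q : ℕ) : ZP p₁ Q) * ((t : ℕ) : ZP p₁ Q)
      = ((((Q : ℕ) : ℤ) * ((t : ℕ) : ℤ) : ℤ) : ZP p₁ Q) := by
    simp only [Int.cast_mul, Int.cast_natCast]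
  have h2 : toPp₁ p₁ Q ((t : ℕ) : ZP p₁ Q) = (((t : ℕ) : ℤ) : ZMod ((p₁ : ℕ+) : ℕ)) := by
    rw [map_natCast]; simp only [Int.cast_natCast]
  rw [h1, h2, ZMod.stdAddChar_coe, ZMod.stdAddChar_coe]
  congr 1
  have hp : ((p₁ : ℕ) : ℂ) ≠ 0 := by exact_mod_cast (PNat.ne_zero p₁)
  have hQ : ((Q : ℕ) : ℂ) ≠ 0 := by exact_mod_cast (PNat.ne_zero Q)
  push_cast
  field_simp

/-- `p₁ ∣ N`. [folklore] -/
theorem p₁_dvd_DDP : ((p₁ : ℕ+) : ℕ) ∣ ((D * D * (p₁ * Q) : ℕ+) : ℕ) :=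
  (Dvd.intro _ (PNat.mul_coe p₁ Q).symm).trans (Dvd.intro_left _ (PNat.mul_coe (D * D) (p₁ * Q)).symm)

/-- The reduction `ℤ_N →+* ℤ_{p₁}` (`x₀ mod p₁`). [folklore] -/
def toP₁ : ZN D p₁ Q →+* ZMod ((p₁ : ℕ+) : ℕ) := ZMod.castHom (p₁_dvd_DDP D p₁ Q) (ZMod ((p₁ : ℕ+) : ℕ))

/-- `toP₁` of an integer. [folklore] -/
theorem toP₁_intCast (z : ℤ) : toP₁ D p₁ Q ((z : ℤ) : ZN D p₁ Q) = ((z : ℤ) : ZMod ((p₁ : ℕ+) : ℕ)) :=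
  map_intCast _ z

/-- `D² ∣ N`. [folklore] -/
theorem DD_dvd_DDP : ((D * D : ℕ+) : ℕ) ∣ ((D * D * (p₁ * Q) : ℕ+) : ℕ) :=
  Dvd.intro _ (PNat.mul_coe (D * D) (p₁ * Q)).symm

/-- The reduction `ℤ_N →+* ℤ_{D²}` (`x₀ mod D²`, a line invariant). [folklore] -/
def toDsq : ZN D p₁ Q →+* ZMod ((D * D : ℕ+) : ℕ) := ZMod.castHom (DD_dvd_DDP D p₁ Q) (ZMod ((D * D : ℕ+) : ℕ))

/-- `toDsq` of an integer. [folklore] -/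
theorem toDsq_intCast (z : ℤ) : toDsq D p₁ Q ((z : ℤ) : ZN D p₁ Q) = ((z : ℤ) : ZMod ((D * D : ℕ+) : ℕ)) :=
  map_intCast _ z

/-- Coordinate `0` of every point of every line is `≡ v′₀ (mod D²)`. [cite: ChenQuantumLattice2024, §3.5.9 p. 35] -/
theorem toDsq_ptB_zero (b v' : Fin (n + 1) → ℤ) (j : ZP p₁ Q) :
    toDsq D p₁ Q (ptB n D p₁ Q b v' j 0) = ((v' 0 : ℤ) : ZMod ((D * D : ℕ+) : ℕ)) := by
  simp only [ptB]
  rw [toDsq_intCast, Int.cast_add]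
  have h0 : ((2 * ((D : ℕ) : ℤ) ^ 2 * ((j.val : ℕ) : ℤ) * b 0 : ℤ) : ZMod ((D * D : ℕ+) : ℕ)) = 0 := by
    rw [ZMod.intCast_zmod_eq_zero_iff_dvd]
    exact ⟨2 * ((j.val : ℕ) : ℤ) * b 0, by push_cast; ring⟩
  rw [h0, zero_add]

/-- `x ↦ x₀ mod D²` is a line invariant (for every class). [cite: ChenQuantumLattice2024, §3.5.9 p. 35] -/
theorem isLineInvariant_toDsq (U : Finset (Fin (n + 1))) (bk : Fin (n + 1) → ℤ) :
    IsLineInvariant n D p₁ Q U bk (fun x => toDsq D p₁ Q (x 0)) :=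
  fun b _ v' j j' => by simp only [toDsq_ptB_zero]

/-- For `gcd(D,p₁) = 1`, an integer is determined mod `D²p₁` by its residues mod `D²` and mod `p₁`.
[folklore] -/
theorem intCast_Dsqp₁_eq_of_residues (hDp : Nat.Coprime (D : ℕ) (p₁ : ℕ)) {z z' : ℤ}
    (hD : ((z : ℤ) : ZMod ((D * D : ℕ+) : ℕ)) = z') (hp : ((z : ℤ) : ZMod ((p₁ : ℕ+) : ℕ)) = z') :
    ((z : ℤ) : ZMod ((D * D * p₁ : ℕ+) : ℕ)) = z' := by
  rw [ZMod.intCast_eq_intCast_iff_dvd_sub] at hD hp ⊢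
  have hc : IsCoprime (((D * D : ℕ+) : ℕ) : ℤ) (((p₁ : ℕ+) : ℕ) : ℤ) := by
    rw [Nat.isCoprime_iff_coprime, PNat.mul_coe]
    exact Nat.Coprime.mul_left hDp hDp
  have e : (((D * D * p₁ : ℕ+) : ℕ) : ℤ) = (((D * D : ℕ+) : ℕ) : ℤ) * (((p₁ : ℕ+) : ℕ) : ℤ) := by
    rw [← Nat.cast_mul, ← PNat.mul_coe]
  rw [e]
  exact hc.mul_dvd hD hp

/-- The public translation `g = 2D⁴Q·bk⁰` (`bk⁰ = bk` off `U`, `0` on `U`).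
[cite: ChenQuantumLattice2024, §3.5.9 p. 35] -/
def step8Shift (U : Finset (Fin (n + 1))) (bk : Fin (n + 1) → ℤ) : Fin (n + 1) → ZN D p₁ Q :=
  fun i => if i ∈ U then 0 else ((2 * ((D : ℕ) : ℤ) ^ 4 * ((Q : ℕ) : ℤ) * bk i : ℤ) : ZN D p₁ Q)

/-- **The Step-8 reading operation** `(E₈ψ)(x) = ψ_{p₁}(x₀ mod p₁) · ψ(x − 2D⁴Q·bk⁰)`: a diagonal phase
after a translation, both PUBLIC (secret-free, offset-free); it is unitary.
[cite: ChenQuantumLattice2024, Claim 3.14 pp. 33–34, §3.5.9 p. 35] -/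
noncomputable def step8Op (U : Finset (Fin (n + 1))) (bk : Fin (n + 1) → ℤ) :
    Ket (n + 1) ((D * D * (p₁ * Q) : ℕ+) : ℕ) →ₗ[ℂ] Ket (n + 1) ((D * D * (p₁ * Q) : ℕ+) : ℕ) where
  toFun ψ := fun x => (ZMod.stdAddChar (toP₁ D p₁ Q (x 0)) : ℂ) * ψ (x - step8Shift n D p₁ Q U bk)
  map_add' ψ φ := by
    funext x
    simp only [Pi.add_apply]
    ring
  map_smul' a ψ := by
    funext x
    simp only [Pi.smul_apply, smul_eq_mul, RingHom.id_apply]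
    ring

/-- `(E₈ψ)(x) = ψ_{p₁}(x₀ mod p₁)·ψ(x − g)`. [folklore] -/
theorem step8Op_apply (U : Finset (Fin (n + 1))) (bk : Fin (n + 1) → ℤ)
    (ψ : Ket (n + 1) ((D * D * (p₁ * Q) : ℕ+) : ℕ)) (x : Fin (n + 1) → ZN D p₁ Q) :
    step8Op n D p₁ Q U bk ψ x
      = (ZMod.stdAddChar (toP₁ D p₁ Q (x 0)) : ℂ) * ψ (x - step8Shift n D p₁ Q U bk) :=
  rfl

/-- The Step-8 parameter step `c = D²Q ∈ ℤ_P`: the public translation `g` moves each class line `c`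
parameter steps along itself. [cite: ChenQuantumLattice2024, §3.5.9 p. 35] -/
def step8Param : ZP p₁ Q := ((((D : ℕ) ^ 2 * (Q : ℕ) : ℕ)) : ZP p₁ Q)

/-- **The translation `g` moves every class line `D²Q` parameter steps along itself**:
`(2D²j·b + v′) + g = 2D²(j + D²Q)·b + v′ (mod N)` for every class secret `b` (`2D⁴Q·b_i ≡ 0 (mod N)` on
`U` because `2p₁ ∣ b_i`). [cite: ChenQuantumLattice2024, §3.5.9 p. 35, eq. (12) p. 17] -/
theorem ptB_add_step8Shift {U : Finset (Fin (n + 1))} {bk b : Fin (n + 1) → ℤ} (hb : InClass n p₁ U bk b)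
    (v' : Fin (n + 1) → ℤ) (j : ZP p₁ Q) :
    ptB n D p₁ Q b v' j + step8Shift n D p₁ Q U bk = ptB n D p₁ Q b v' (j + step8Param D p₁ Q) := by
  have hj : (((j.val : ℕ) : ℤ) : ZP p₁ Q) = j := by rw [Int.cast_natCast, ZMod.natCast_zmod_val]
  have e1 : ptB n D p₁ Q b v' j = ptB n D p₁ Q b v' (((j.val : ℕ) : ℤ) : ZP p₁ Q) := by rw [hj]
  have e2 : j + step8Param D p₁ Q
      = ((((j.val : ℕ) : ℤ) + ((D : ℕ) : ℤ) ^ 2 * ((Q : ℕ) : ℤ) : ℤ) : ZP p₁ Q) := by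
    unfold step8Param
    rw [Int.cast_add, hj]
    push_cast
    ring
  rw [e1, e2, ptB_intCast, ptB_intCast]
  funext i
  simp only [Pi.add_apply, dirStep, step8Shift]
  by_cases hi : i ∈ U
  · rw [if_pos hi, add_zero]
    obtain ⟨e, he⟩ := hb.2 i hi
    rw [he, add_right_inj, ZMod.intCast_eq_intCast_iff_dvd_sub]
    have hN : (((D * D * (p₁ * Q) : ℕ+) : ℕ) : ℤ)
        = ((D : ℕ) : ℤ) * ((D : ℕ) : ℤ) * (((p₁ : ℕ) : ℤ) * ((Q : ℕ) : ℤ)) := by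
      simp only [PNat.mul_coe, Nat.cast_mul]
    rw [hN]
    exact ⟨4 * ((D : ℕ) : ℤ) ^ 2 * e, by ring⟩
  · rw [if_neg hi, hb.1 i hi]
    push_cast
    ring

/-- **E₈ stabilises every class line ket, with eigenvalue `ψ_{p₁}(v′₀)·ψ_P(−D⁴Q²)`** (odd `P`, `0 ∉ U`,
`bk₀ = −1`).  So `E₈` is a class-non-demolition operation whose eigenvalue reads `v′₀ mod p₁`.
[cite: ChenQuantumLattice2024, Claim 3.14 pp. 33–34, §3.5.9 p. 35, eq. (12) p. 17] -/
theorem step8Op_phi8bKet (hP : Odd ((p₁ * Q : ℕ+) : ℕ)) {U : Finset (Fin (n + 1))}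
    (hU : (0 : Fin (n + 1)) ∉ U) {bk : Fin (n + 1) → ℤ} (hbk0 : bk 0 = -1) {b : Fin (n + 1) → ℤ}
    (hb : InClass n p₁ U bk b) (v' : Fin (n + 1) → ℤ) :
    step8Op n D p₁ Q U bk (phi8bKet n D p₁ Q b v')
      = ((ZMod.stdAddChar (((v' 0 : ℤ)) : ZMod ((p₁ : ℕ+) : ℕ)) : ℂ)
          * (ZMod.stdAddChar (-(step8Param D p₁ Q ^ 2) : ZP p₁ Q) : ℂ))
        • phi8bKet n D p₁ Q b v' := by
  have hb0 := InClass.apply_zero n p₁ hU hbk0 hb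
  have hval : ∀ i : ZP p₁ Q, phi8bKet n D p₁ Q b v' (ptB n D p₁ Q b v' i)
      = (ZMod.stdAddChar (-(i ^ 2) : ZP p₁ Q) : ℂ) := fun i => by
    rw [phi8bKet_eq_profileKet, profileKet_apply_ptB n D p₁ Q b v' hP hb0]
  funext x
  rw [step8Op_apply, Pi.smul_apply, smul_eq_mul]
  by_cases hx : ∃ j, x = ptB n D p₁ Q b v' j
  · obtain ⟨j, rfl⟩ := hx
    have hxg : ptB n D p₁ Q b v' j - step8Shift n D p₁ Q U bk
        = ptB n D p₁ Q b v' (j - step8Param D p₁ Q) := by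
      rw [sub_eq_iff_eq_add, ptB_add_step8Shift n D p₁ Q hb v' (j - step8Param D p₁ Q), sub_add_cancel]
    rw [hxg, hval, hval]
    have h0 : toP₁ D p₁ Q (ptB n D p₁ Q b v' j 0)
        = (((v' 0 : ℤ)) : ZMod ((p₁ : ℕ+) : ℕ))
          + -(2 * ((D : ℕ) : ZMod ((p₁ : ℕ+) : ℕ)) ^ 2 * ((j.val : ℕ) : ZMod ((p₁ : ℕ+) : ℕ))) := by
      simp only [ptB, hb0]
      rw [toP₁_intCast]
      push_cast
      ring
    have e1 : (-((j - step8Param D p₁ Q) ^ 2) : ZP p₁ Q)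
        = -(j ^ 2) + ((Q : ℕ) : ZP p₁ Q) * (2 * ((D : ℕ) : ZP p₁ Q) ^ 2 * j)
          + -(step8Param D p₁ Q ^ 2) := by
      unfold step8Param
      push_cast
      ring
    have h1 : (ZMod.stdAddChar (-((j - step8Param D p₁ Q) ^ 2) : ZP p₁ Q) : ℂ)
        = (ZMod.stdAddChar (-(j ^ 2) : ZP p₁ Q) : ℂ)
          * (ZMod.stdAddChar (((Q : ℕ) : ZP p₁ Q) * (2 * ((D : ℕ) : ZP p₁ Q) ^ 2 * j) : ZP p₁ Q) : ℂ)
          * (ZMod.stdAddChar (-(step8Param D p₁ Q ^ 2) : ZP p₁ Q) : ℂ) := by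
      rw [e1, AddChar.map_add_eq_mul, AddChar.map_add_eq_mul]
    have h2' : toPp₁ p₁ Q (2 * ((D : ℕ) : ZP p₁ Q) ^ 2 * j)
        = 2 * ((D : ℕ) : ZMod ((p₁ : ℕ+) : ℕ)) ^ 2 * ((j.val : ℕ) : ZMod ((p₁ : ℕ+) : ℕ)) := by
      rw [map_mul, map_mul, map_pow, map_natCast, map_ofNat, toPp₁_eq_natCast_val]
    have h2 : (ZMod.stdAddChar (((Q : ℕ) : ZP p₁ Q) * (2 * ((D : ℕ) : ZP p₁ Q) ^ 2 * j) : ZP p₁ Q) : ℂ)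
        = (ZMod.stdAddChar
            (2 * ((D : ℕ) : ZMod ((p₁ : ℕ+) : ℕ)) ^ 2 * ((j.val : ℕ) : ZMod ((p₁ : ℕ+) : ℕ))) : ℂ) := by
      rw [stdAddChar_Q_mul, h2']
    have h3 : (ZMod.stdAddChar
          (-(2 * ((D : ℕ) : ZMod ((p₁ : ℕ+) : ℕ)) ^ 2 * ((j.val : ℕ) : ZMod ((p₁ : ℕ+) : ℕ)))) : ℂ)
        * (ZMod.stdAddChar
          (2 * ((D : ℕ) : ZMod ((p₁ : ℕ+) : ℕ)) ^ 2 * ((j.val : ℕ) : ZMod ((p₁ : ℕ+) : ℕ))) : ℂ) = 1 := by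
      rw [← AddChar.map_add_eq_mul, neg_add_cancel]
      exact AddChar.map_zero_eq_one _
    rw [h0, AddChar.map_add_eq_mul, h1, h2]
    linear_combination
      ((ZMod.stdAddChar (((v' 0 : ℤ)) : ZMod ((p₁ : ℕ+) : ℕ)) : ℂ)
        * (ZMod.stdAddChar (-(step8Param D p₁ Q ^ 2) : ZP p₁ Q) : ℂ)
        * (ZMod.stdAddChar (-(j ^ 2) : ZP p₁ Q) : ℂ)) * h3
  · have hx' : ∀ j, x ≠ ptB n D p₁ Q b v' j := fun j h => hx ⟨j, h⟩
    have hxg : ∀ j, x - step8Shift n D p₁ Q U bk ≠ ptB n D p₁ Q b v' j := by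
      intro j h
      apply hx' (j + step8Param D p₁ Q)
      rw [← ptB_add_step8Shift n D p₁ Q hb v' j, ← h, sub_add_cancel]
    unfold phi8bKet
    rw [lineKet_apply_of_ne _ _ hxg, lineKet_apply_of_ne _ _ hx', mul_zero, mul_zero]

/-- `E₈` is a class-non-demolition operation. [cite: ChenQuantumLattice2024, Claim 3.14 pp. 33–34, §3.5.9 p. 35] -/
theorem isClassND_step8Op (hP : Odd ((p₁ * Q : ℕ+) : ℕ)) {U : Finset (Fin (n + 1))}
    (hU : (0 : Fin (n + 1)) ∉ U) {bk : Fin (n + 1) → ℤ} (hbk0 : bk 0 = -1) :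
    IsClassND n D p₁ Q U bk (step8Op n D p₁ Q U bk) :=
  fun _ hb v' => ⟨_, step8Op_phi8bKet n D p₁ Q hP hU hbk0 hb v'⟩

/-- The eigenvalue of `E₈` at offset `v′` is `ψ_{p₁}(v′₀)·ψ_P(−D⁴Q²)`.
[cite: ChenQuantumLattice2024, Claim 3.14 pp. 33–34, §3.5.9 p. 35] -/
theorem ndValue_step8Op (hP : Odd ((p₁ * Q : ℕ+) : ℕ)) {U : Finset (Fin (n + 1))}
    (hU : (0 : Fin (n + 1)) ∉ U) {bk : Fin (n + 1) → ℤ} (hbk0 : bk 0 = -1) {b : Fin (n + 1) → ℤ}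
    (hb : InClass n p₁ U bk b) (v' : Fin (n + 1) → ℤ) :
    ndValue n D p₁ Q (step8Op n D p₁ Q U bk) b v'
      = (ZMod.stdAddChar (((v' 0 : ℤ)) : ZMod ((p₁ : ℕ+) : ℕ)) : ℂ)
          * (ZMod.stdAddChar (-(step8Param D p₁ Q ^ 2) : ZP p₁ Q) : ℂ) :=
  ndValue_spec n D p₁ Q hP (InClass.apply_zero n p₁ hU hbk0 hb) (step8Op_phi8bKet n D p₁ Q hP hU hbk0 hb v')

/-! ### T4, operator form: what non-demolition operations learn about the offset is exactly its class -/

/-- **What a non-demolition operation can learn about the offset is EXACTLY its class.**  For odd `p₁`,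
odd `Q`, `gcd(D,p₁) = gcd(p₁,Q) = 1`, `0 ∉ U ≠ ∅`, `bk₀ = −1`, `2p₁ ∣ bk` on `U`, and any class secret `b`:
two offsets `v′, v″` receive the same eigenvalue from EVERY class-non-demolition operation iff
`v″ ≡ v′ + d(a,c) (mod N)` for a class shift `d(a,c) = D²p₁(a·bk + c·𝟙_U)`.  (`⇒` uses the operations
`𝟙_M` of the line invariants and `E₈`; `⇐` is `ndValue_classShift`.)  Together with
`offset_indistinguishable_iff` and `centreError`: the information any state-preserving processing of
`|φ8.b⟩` offers is blind to the centre correction Step 9 needs.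
[cite: ChenQuantumLattice2024, §3.5.9 pp. 34–38, Claim 3.14 pp. 33–34, eq. (12) p. 17] -/
theorem nd_indistinguishable_iff (hp : Odd ((p₁ : ℕ+) : ℕ)) (hQ : Odd ((Q : ℕ+) : ℕ))
    (hDp : Nat.Coprime (D : ℕ) (p₁ : ℕ)) (hpQ : Nat.Coprime (p₁ : ℕ) (Q : ℕ))
    (U : Finset (Fin (n + 1))) (hU : (0 : Fin (n + 1)) ∉ U) (hU' : U.Nonempty)
    (bk : Fin (n + 1) → ℤ) (hbk0 : bk 0 = -1) (hbk : ∀ i, i ∈ U → (2 * ((p₁ : ℕ) : ℤ)) ∣ bk i)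
    {b : Fin (n + 1) → ℤ} (hb : InClass n p₁ U bk b) (v' v'' : Fin (n + 1) → ℤ) :
    (∀ E : Ket (n + 1) ((D * D * (p₁ * Q) : ℕ+) : ℕ) →ₗ[ℂ] Ket (n + 1) ((D * D * (p₁ * Q) : ℕ+) : ℕ),
        IsClassND n D p₁ Q U bk E → ndValue n D p₁ Q E b v' = ndValue n D p₁ Q E b v'')
      ↔ ∃ (a : ZQ Q) (c : Fin (n + 1) → ZQ Q),
          ∀ i, ((v'' i : ℤ) : ZN D p₁ Q) = ((v' i + classShift n D p₁ Q U bk a c i : ℤ) : ZN D p₁ Q) := by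
  classical
  have hP : Odd ((p₁ * Q : ℕ+) : ℕ) := by rw [PNat.mul_coe]; exact Nat.odd_mul.2 ⟨hp, hQ⟩
  have hb0 := InClass.apply_zero n p₁ hU hbk0 hb
  constructor
  · intro h
    -- every Prop-valued line invariant agrees on `v′` and `v″`
    have hinv : ∀ f : (Fin (n + 1) → ZN D p₁ Q) → Prop, IsLineInvariant n D p₁ Q U bk f →
        (f (fun i => ((v' i : ℤ) : ZN D p₁ Q)) ↔ f (fun i => ((v'' i : ℤ) : ZN D p₁ Q))) := by
      intro f hf
      have hE : IsClassND n D p₁ Q U bk (branchOp {x | f x}) := fun b₂ hb₂ w =>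
        (isLineInvariant_mem_iff_nonDisturbing n D p₁ Q hP U hU bk hbk0 _ (chirp_ne_zero p₁ Q)
          {x | f x}).1 hf b₂ hb₂ w
      have hv := h _ hE
      rw [ndValue_branchOp n D p₁ Q b v' hP hb0, ndValue_branchOp n D p₁ Q b v'' hP hb0] at hv
      by_cases h1 : (fun i => ((v' i : ℤ) : ZN D p₁ Q)) ∈ {x | f x}
      · by_cases h2 : (fun i => ((v'' i : ℤ) : ZN D p₁ Q)) ∈ {x | f x}
        · exact ⟨fun _ => h2, fun _ => h1⟩
        · rw [if_pos h1, if_neg h2] at hv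
          exact absurd hv one_ne_zero
      · by_cases h2 : (fun i => ((v'' i : ℤ) : ZN D p₁ Q)) ∈ {x | f x}
        · rw [if_neg h1, if_pos h2] at hv
          exact absurd hv.symm one_ne_zero
        · exact ⟨fun h' => absurd h' h1, fun h' => absurd h' h2⟩
    refine (offset_indistinguishable_iff n D p₁ Q hp hQ U hU bk hbk0 hbk v' v'').1 ⟨hinv, ?_⟩
    -- the Step-8 data agree: mod `p₁` by `E₈`, mod `D²` by the line invariant `x₀ mod D²`
    have h8 := h _ (isClassND_step8Op n D p₁ Q hP hU hbk0)
    rw [ndValue_step8Op n D p₁ Q hP hU hbk0 hb, ndValue_step8Op n D p₁ Q hP hU hbk0 hb] at h8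
    have hmodp : (((v' 0 : ℤ)) : ZMod ((p₁ : ℕ+) : ℕ)) = (((v'' 0 : ℤ)) : ZMod ((p₁ : ℕ+) : ℕ)) :=
      stdAddChar_injective (mul_right_cancel₀ (stdAddChar_ne_zero _) h8)
    have hmodD : (((v' 0 : ℤ)) : ZMod ((D * D : ℕ+) : ℕ)) = (((v'' 0 : ℤ)) : ZMod ((D * D : ℕ+) : ℕ)) := by
      have hf : IsLineInvariant n D p₁ Q U bk
          (fun x => toDsq D p₁ Q (x 0) = (((v' 0 : ℤ)) : ZMod ((D * D : ℕ+) : ℕ))) :=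
        fun b₂ _ w j j' => by simp only [toDsq_ptB_zero]
      have h1 := (hinv _ hf).1 (by simp only [toDsq_intCast])
      simp only [toDsq_intCast] at h1
      exact h1.symm
    rw [toStep8_intCast, toStep8_intCast]
    exact intCast_Dsqp₁_eq_of_residues D p₁ hDp hmodD hmodp
  · rintro ⟨a, c, hac⟩ E hE
    rw [ndValue_congr n D p₁ Q E b (v'' := fun i => v' i + classShift n D p₁ Q U bk a c i) hac]
    exact (hE.ndValue_classShift hP hQ hpQ hU hU' hbk0 hb v' a c).symm

end Line

end Literature.Computability.Cryptography.Chen2024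

/-! ### Applied to an admissible shape -/

namespace Literature.Computability.Cryptography.Chen2024.Shape

open scoped BigOperators

variable (S : Shape)

/-- **T4, operator form, for Chen's shapes.**  `S` admissible, `U` a non-empty set of unknown coordinates
with `0 ∉ U`, `bk` a public vector agreeing with `S.b` off `U`, `b₂` any class secret (another LWE
instance with the same planted part): every class-non-demolition operation `E` has the same eigenvalue on
the true line ket `|φ_{S.b, v′}⟩` and on `|φ_{b₂, v′ + d(a,c)}⟩` for every class shift `d(a,c)`.
[cite: ChenQuantumLattice2024, §3.5.9 pp. 34–38, Claim 3.14 pp. 33–34, eq. (12) p. 17, Cond. C.3 p. 18] -/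
theorem ndValue_class_blind (h : S.Admissible) (U : Finset (Fin (S.n + 1))) (hU : (0 : Fin (S.n + 1)) ∉ U)
    (hU' : U.Nonempty) (bk b₂ : Fin (S.n + 1) → ℤ) (hbk : ∀ i, i ∉ U → bk i = S.b i)
    (hb₂ : ∀ i, i ∉ U → b₂ i = S.b i) (hb₂U : ∀ i ∈ U, (2 * (S.p₁ : ℤ)) ∣ b₂ i)
    (E : Ket (S.n + 1) ((S.D * S.D * (S.p₁ * S.Q) : ℕ+) : ℕ)
      →ₗ[ℂ] Ket (S.n + 1) ((S.D * S.D * (S.p₁ * S.Q) : ℕ+) : ℕ))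
    (hE : IsClassND S.n S.D S.p₁ S.Q U bk E) (v' : Fin (S.n + 1) → ℤ) (a : ZQ S.Q)
    (c : Fin (S.n + 1) → ZQ S.Q) :
    ndValue S.n S.D S.p₁ S.Q E S.b v'
      = ndValue S.n S.D S.p₁ S.Q E b₂ (fun i => v' i + classShift S.n S.D S.p₁ S.Q U bk a c i) := by
  have hbk0 : bk 0 = -1 := by rw [hbk 0 hU, h.b_head]
  have hSb : InClass S.n S.p₁ U bk S.b :=
    ⟨fun i hi => (hbk i hi).symm, fun i hi => h.b_tail i (fun h0 => hU (h0 ▸ hi))⟩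
  have hb₂' : InClass S.n S.p₁ U bk b₂ :=
    ⟨fun i hi => (hb₂ i hi).trans (hbk i hi).symm, fun i hi => hb₂U i hi⟩
  exact hE.ndValue_class_blind h.odd_P h.odd_Q h.cop_pQ hU hU' hbk0 hSb hb₂' v' a c

/-- **T4, operator form, for Chen's shapes: what the class-non-demolition operations can tell about the
offset of the true line ket is EXACTLY its class** (`S` admissible, `U ≠ ∅`, `0 ∉ U`, `bk = S.b` off `U`,
`2p₁ ∣ bk` on `U`). [cite: ChenQuantumLattice2024, §3.5.9 pp. 34–38, Claim 3.14 pp. 33–34, eq. (12) p. 17, Cond. C.3 p. 18] -/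
theorem nd_indistinguishable_iff (h : S.Admissible) (U : Finset (Fin (S.n + 1)))
    (hU : (0 : Fin (S.n + 1)) ∉ U) (hU' : U.Nonempty) (bk : Fin (S.n + 1) → ℤ)
    (hbk : ∀ i, i ∉ U → bk i = S.b i) (hbkU : ∀ i, i ∈ U → (2 * (S.p₁ : ℤ)) ∣ bk i)
    (v' v'' : Fin (S.n + 1) → ℤ) :
    (∀ E : Ket (S.n + 1) ((S.D * S.D * (S.p₁ * S.Q) : ℕ+) : ℕ)
        →ₗ[ℂ] Ket (S.n + 1) ((S.D * S.D * (S.p₁ * S.Q) : ℕ+) : ℕ),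
        IsClassND S.n S.D S.p₁ S.Q U bk E →
          ndValue S.n S.D S.p₁ S.Q E S.b v' = ndValue S.n S.D S.p₁ S.Q E S.b v'')
      ↔ ∃ (a : ZQ S.Q) (c : Fin (S.n + 1) → ZQ S.Q), ∀ i,
          ((v'' i : ℤ) : ZN S.D S.p₁ S.Q)
            = ((v' i + classShift S.n S.D S.p₁ S.Q U bk a c i : ℤ) : ZN S.D S.p₁ S.Q) := by
  have hbk0 : bk 0 = -1 := by rw [hbk 0 hU, h.b_head]
  have hSb : InClass S.n S.p₁ U bk S.b :=
    ⟨fun i hi => (hbk i hi).symm, fun i hi => h.b_tail i (fun h0 => hU (h0 ▸ hi))⟩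
  exact Chen2024.nd_indistinguishable_iff S.n S.D S.p₁ S.Q h.odd_p₁ h.odd_Q h.cop_Dp h.cop_pQ U hU hU'
    bk hbk0 hbkU hSb v' v''

end Literature.Computability.Cryptography.Chen2024.Shape
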